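import Summits.SmoothPoincare4.SmoothPoincare4.Theses.CylinderEntropy
import Literature.Geometry.Riemannian.SphericalCylinderEntropy
import Literature.Geometry.Manifold.CylinderSlice
import Summits.SmoothPoincare4.SmoothPoincare4.Theorems.CylinderEntropyThinCrossSectionExistsStubHamiltonConvex
import Summits.SmoothPoincare4.SmoothPoincare4.Theorems.CylinderEntropyThinCrossSectionExistsStubHarnackRadialOfConvex
import Summits.SmoothPoincare4.SmoothPoincare4.Theorems.CylinderEntropyThinCrossSectionExistsStubZonalMonotone
import Summits.SmoothPoincare4.SmoothPoincare4.Theorems.CylinderEntropyThinCrossSectionExistsStubKernelDomination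
import Summits.SmoothPoincare4.SmoothPoincare4.Theorems.CylinderEntropyThinCrossSectionExistsStubLevelComparison
import Summits.SmoothPoincare4.SmoothPoincare4.Theorems.CylinderEntropyThinCrossSectionExistsStubLayerCakeCore
import Summits.SmoothPoincare4.SmoothPoincare4.Theorems.CylinderEntropyThinCrossSectionExistsSliceBallMass
import Summits.SmoothPoincare4.SmoothPoincare4.Theorems.CylinderEntropyThinCrossSectionExistsStubFunkHeckeVanishing
import Summits.SmoothPoincare4.SmoothPoincare4.Theorems.CylinderEntropyThinCrossSectionExistsStubZonalSphereIntegral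
import Summits.SmoothPoincare4.SmoothPoincare4.Theorems.CylinderEntropyThinCrossSectionExistsStubSliceDensity

/-!
# Skeleton line `ball-mass-slack` for crux `ThinCrossSectionExists` (stmt-SmoothPoincare4-7633) — LEAD-1 RESHAPE (cycle 1 of the re-seat)

Lead-1: prover-line-stmt-SmoothPoincare4-7633-1 (2026-08-16T10:13Z–).  RESHAPE OF THIS CYCLE: the composition of lead-0 still
carried the route's support item `SliceCalibration` (7634, open) as a hypothesis `hcal`; it is now DISCHARGED INSIDE THE LINE by
three new registered stubs over tree vocabulary only (`gegen`, `zonal`, `cylDensity`, Mathlib's `μHE`) —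
`stub_funkHeckeVanishing` (K1), `stub_zonalSphereIntegral` (K2), `stub_sliceDensity` (K3), §2b — and the glue §3b proves
`sliceCalibration_holds : SliceCalibration` from them, so that `ThinCrossSectionExists_of (hD : stub_massSlackIntr)` has the
crux-equivalent supply D as its ONLY hypothesis.  D itself is unchanged and remains the lead's `promote-stub` verdict.

Lead-0: prover-line-stmt-SmoothPoincare4-7633-0 (2026-08-16).  STATUS: of the seven registered stubs SIX ARE LANDED AND PROVED
(unconditionally, axioms ⊆ {propext, Classical.choice, Quot.sound}) and wired in below by their tree names:

* `stub_hamiltonConvex` — p93995 (Hamilton's matrix Harnack estimate for the heat kernel of the round `S⁴`, radial form: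
  `θ ↦ log 𝔥(τ, cos θ) + θ²/4τ` convex on `[-π,π]`, `𝔥 > 0`; proved in `Literature.Geometry.Riemannian.SphericalZonalHamiltonHarnack`
  by a 1-D Li–Yau–Hamilton maximum principle for `log(zonal + ε)` in the `s`-variable, time shift, `ε → 0`; the named fact
  `SphereHeatKernelHarnack.HamiltonLogConvexSphereFour` (p89417) is DISCHARGED);
* `stub_harnackRadial_of_convex` — p78724 (even convex functions are monotone on `[0,π]`);
* `stub_zonalMonotone` — p86444 (Cheeger–Yau radial monotonicity of the `S⁴` kernel, proved via `∂_s 𝔥₄ = 5e^{-4τ}𝔥₆` and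
  positivity of the `S⁶` kernel by the energy method + duality: `Literature.Geometry.Riemannian.SphericalZonalSixPositivity`);
* `stub_kernelDomination` — p88929 (antitone radial profile dominating the kernel, exact on the slice);
* `stub_levelComparison` — p78255 (ball-mass slack ⇒ superlevel-set slack);
* `stub_layerCakeCore` — p78271 (`lintegral` layer cake);
* hence the LEVER `λ_cyl(S) ≤ Λ·λ_cyl(slice₀)` for every `Λ`-subspherical `S ⊆ N` is an unconditional theorem
  (`Theorems/CylinderEntropyThinCrossSectionExistsLever.lean`, `ballMass_cylEntropy_le_mul`).
* `stub_massSlackIntr` (D, the supply "every homotopy 4-sphere has a cross-section with `m_N < 4/e`") is the ONLY open stub and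
  carries the crux: `SPC4 ⇒ D` (`ballMass_slice_le`, p90628: the slice is `1`-subspherical from every centre; §6 below) and
  `D ⇒ E` (this composition) and `D ∧ R ⇒ SPC4` (`massRigid`): D is crux-equivalent modulo R and the `≤ 1` half of the
  calibration — lead's verdict `promote-stub` (the planner promotes D to an item / re-lines the crux on it).

All seven signatures are written over Mathlib + `Literature.Geometry.Riemannian.SphericalCylinderEntropy` (`zonal`, `cylKernel`,
`cylDensity`) ONLY (every set / distance / base point inlined), so each stub is a pure-proof `Theorems/` file glued here by name.
The §1 definitions are readability aliases (definitionally the inlined text).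

Composition `ThinCrossSectionExists_of : H → A' → B → C-dom → C-level → C-core → K1 → K2 → K3 → D → E` is proved below
(no `sorry` outside `stub_massSlackIntr`; K1–K3 are landed theorems p96785 / p97290 / p96858, wired in by tree name).

## Disproof used (`Cruxes/ThinCrossSectionExists/Disproof.lean`, cdisprove cycle 2; `Negative/FrameAnalysis.lean` p72115)
`crux_iff_spc4` (E ⇔ SPC4 given R + calibration): D is where SPC4 lives (`massRigid`); `false_without_*`: the frame is used
verbatim and only at D; `not_thinAtLevel_of_le_one`: D's `Λ ∈ [1, 4/e)`; `two_le_cylEntropy_twoSlices`: ball mass is additive (two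
slices `Λ = 2`); `not_strongE`: D is an `∃`.  Nothing in the Disproof bears on H, A', B, C-* (kernel and measure statements, now
theorems); `ledger negatives` for the crux: 0.
-/

noncomputable section

set_option linter.dupNamespace false
set_option linter.unusedVariables false

open scoped BigOperators Topology Manifold MeasureTheory ENNReal NNReal ContDiff ContinuousMap
open Set Function MeasureTheory
open Literature.Geometry.Riemannian.SphericalCylinderEntropy (cylEntropy cylDensity cylKernel zonal gegen)
open Literature.Geometry.Manifold.CylinderSlice (sliceMap range_sliceMap sum_sq_sliceMap
  isSmoothEmbedding_sliceMap separatesEnds_of_slice_subset)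

namespace Summit.SmoothPoincare4.SmoothPoincare4.Cruxes.ThinCrossSectionExists.BallMassSlack

open Summit.SmoothPoincare4.SmoothPoincare4.Theses.CylinderEntropy (ThinCrossSectionExists
  CylinderRungTwo SliceCalibration)

local notation "E⁶" => EuclideanSpace ℝ (Fin 6)
local notation "E⁴" => EuclideanSpace ℝ (Fin 4)
local notation "𝕊⁴" => (Metric.sphere (0 : EuclideanSpace ℝ (Fin 5)) 1)

/-! ## §0 The crux through named pieces (verbatim sub-expressions of the item) -/

/-- `z ∈ N = S⁴×ℝ ⊂ ℝ⁶`, literally as in the items. -/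
def InN (z : E⁶) : Prop := ∑ i : Fin 5, z (Fin.castSucc i) ^ 2 = 1

/-- `N` as a set. -/
def cylN : Set E⁶ := {z | InN z}

/-- "separates the two ends of `N`", literally as in the items. -/
def Separates (A : Set E⁶) : Prop :=
  ∃ R : ℝ, ∀ a b : E⁶, InN a → InN b → a 5 ≤ -R → R ≤ b 5 → ¬ JoinedIn (cylN \ A) a b

/-- The unit slice `S⁴ × {0}` (the set of item 7634). -/
def slice₀ : Set E⁶ := {z : E⁶ | ∑ i : Fin 5, z (Fin.castSucc i) ^ 2 = 1 ∧ z 5 = 0}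

/-- The bubble-sheet threshold `4/e` as typed. -/
def level : ℝ≥0∞ := ENNReal.ofReal (4 / Real.exp 1)

/-- E's four conjuncts for a given `M` at threshold `c`. -/
def CrossSectionBelow (c : ℝ≥0∞) (M : Type) [TopologicalSpace M] [ChartedSpace E⁴ M] : Prop :=
  ∃ ι : M → E⁶, Manifold.IsSmoothEmbedding (𝓡 4) (𝓡 6) ∞ ι ∧ (∀ x, InN (ι x)) ∧
    Separates (Set.range ι) ∧ cylEntropy (Set.range ι) < c

/-- The crux is literally `∀` homotopy 4-spheres, `CrossSectionBelow level` (definitional unfolding only). -/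
theorem crux_iff :
    ThinCrossSectionExists ↔
      ∀ (M : Type) [TopologicalSpace M] [T2Space M] [SecondCountableTopology M]
        [ChartedSpace E⁴ M] [IsManifold (𝓡 4) ∞ M], M ≃ₕ 𝕊⁴ → CrossSectionBelow level M :=
  Iff.rfl

/-- The support item `SliceCalibration` (7634) is literally `λ_cyl(slice₀) = 1`. -/
theorem sliceCalibration_iff : SliceCalibration ↔ cylEntropy slice₀ = 1 := Iff.rfl

/-! ## §1 Intrinsic balls of `N` and subspherical ball mass (readability aliases of the inlined expressions) -/

/-- Reference point `e₀ = (1,0,0,0,0,0)` on the slice. -/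
def e₀ : E⁶ := EuclideanSpace.single 0 1

theorem inN_e₀ : InN e₀ := by
  unfold InN e₀
  rw [Finset.sum_eq_single (0 : Fin 5)]
  · simp
  · intro i _ hi
    have : (Fin.castSucc i : Fin 6) ≠ 0 := fun h => hi (Fin.castSucc_eq_zero_iff.1 h)
    simp [this]
  · simp

theorem e₀_apply_five : e₀ 5 = 0 := by
  simp [e₀]

/-- Product (intrinsic) distance on `N = S⁴ × ℝ`: `d_N(y,p) = √(arccos⟨y',p'⟩² + (y₅ - p₅)²)`. -/
def dN (y p : E⁶) : ℝ :=
  Real.sqrt (Real.arccos (∑ i : Fin 5, y (Fin.castSucc i) * p (Fin.castSucc i)) ^ 2 + (y 5 - p 5) ^ 2)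

/-- Closed intrinsic ball of `N` around `p`, radius `r`. -/
def intrBall (p : E⁶) (r : ℝ) : Set E⁶ :=
  {y : E⁶ | ∑ i : Fin 5, y (Fin.castSucc i) ^ 2 = 1 ∧
    Real.arccos (∑ i : Fin 5, y (Fin.castSucc i) * p (Fin.castSucc i)) ^ 2 + (y 5 - p 5) ^ 2 ≤ r ^ 2}

/-- **`Λ`-subspherical intrinsic ball mass** (inlined form = the registered text). -/
def SubsphericalMassIntr (Λ : ℝ≥0∞) (S : Set E⁶) : Prop :=
  ∀ p : E⁶, InN p → ∀ r : ℝ, 0 < r → μH[4] (S ∩ intrBall p r) ≤ Λ * μH[4] (slice₀ ∩ intrBall e₀ r)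

/-! ## §2 The seven registered stubs (signatures over Mathlib + `zonal` / `cylKernel` / `cylDensity` only) -/
/-- STUB H (`stub_hamiltonConvex`; DEEP, TRUE — cited).  For every `τ > 0` the typed zonal kernel
`𝔥(τ,·) = zonal τ` of `S⁴` is positive along every great circle and `θ ↦ log 𝔥(τ, cos θ) + θ²/(4τ)` is convex on
`[-π, π]`.  WHY TRUE: `𝔥(τ, cos θ) = vol(S⁴)·H(τ, γ(θ), p')` for a unit-speed great circle `γ` through `p'`
(zonal expansion of the heat kernel of `S⁴`: eigenvalues `k(k+3)`, zonal harmonics `(2k+3)/3·C_k^{(3/2)}`); `H > 0`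
(strict positivity of the heat kernel of a closed manifold) and Hamilton's matrix Harnack estimate
`∇²log H + g/(2τ) ≥ 0` (compact, `sec ≥ 0`, `∇Ric = 0`; R. S. Hamilton, Comm. Anal. Geom. 1 (1993) 113–126,
Thm 1.1 / Cor. 1.2) give `(log H∘γ)'' ≥ -1/(2τ)` on `ℝ`, i.e. convexity of `log 𝔥(τ, cos θ) + θ²/4τ`.
NUMERICS: three triage seats + planner, 0 violations (`min (2τ f'' + 1) ≈ τ(1 - O(τ)) > 0`).  In Lean this is a
named Literature fact to be discharged by a literature-prover (maximum principle for Hamilton's quantity on `S⁴`);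
the lead files it as `[cite]` fact.  Leans on: tree `zonal`; Mathlib `ConvexOn`, `Real.log`, `Real.cos`. -/
theorem stub_hamiltonConvex :
    ∀ τ : ℝ, 0 < τ →
        (∀ θ : ℝ, 0 < zonal τ (Real.cos θ)) ∧
          ConvexOn ℝ (Set.Icc (-Real.pi) Real.pi)
            (fun θ : ℝ => Real.log (zonal τ (Real.cos θ)) + θ ^ 2 / (4 * τ)) :=
  -- LANDED (p93995): Theorems/CylinderEntropyThinCrossSectionExistsStubHamiltonConvex.lean
  Summit.SmoothPoincare4.SmoothPoincare4.Theorems.ThinCrossSectionExists.BallMassSlack.stub_hamiltonConvex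

/-- STUB A' (`stub_harnackRadial_of_convex`; size S, pure convexity).  H ⇒ the planner's STUB A: for `τ > 0`,
`θ ↦ 𝔥(τ, cos θ)·e^{θ²/4τ}` is non-decreasing on `[0, π]`.  PROOF: `φ(θ) = log 𝔥(τ, cos θ) + θ²/4τ` is convex on
`[-π, π]` and EVEN (`cos` even), hence `φ(0) ≤ (φ(θ) + φ(-θ))/2 = φ(θ)`, so `φ` is minimised at `0`; a convex
function minimised at the left end of `[0, π]` is non-decreasing there (three-slope inequality,
`ConvexOn.slope_mono_adjacent` / `ConvexOn.monotoneOn_of_…`); exponentiate (`𝔥 > 0`):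
`𝔥(τ,cos θ) e^{θ²/4τ} = exp φ(θ)`.  Leans on: Mathlib `ConvexOn`, `Real.exp_log`, `Real.exp_monotone`. -/
theorem stub_harnackRadial_of_convex :
    (∀ τ : ℝ, 0 < τ →
        (∀ θ : ℝ, 0 < zonal τ (Real.cos θ)) ∧
          ConvexOn ℝ (Set.Icc (-Real.pi) Real.pi)
            (fun θ : ℝ => Real.log (zonal τ (Real.cos θ)) + θ ^ 2 / (4 * τ))) →
      ∀ τ : ℝ, 0 < τ →
        MonotoneOn (fun θ : ℝ => zonal τ (Real.cos θ) * Real.exp (θ ^ 2 / (4 * τ))) (Set.Icc 0 Real.pi) :=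
  -- LANDED (p78724): Theorems/CylinderEntropyThinCrossSectionExists…
  Summit.SmoothPoincare4.SmoothPoincare4.Theorems.ThinCrossSectionExists.BallMassSlack.stub_harnackRadial_of_convex

/-- STUB B (`stub_zonalMonotone`; DEEP, TRUE — cited; unchanged from the planner's skeleton).  For `τ > 0`,
`s ↦ 𝔥(τ, s)` is non-decreasing on `[-1, 1]`: the heat kernel of the round `S⁴` is a non-increasing function of
the geodesic distance `arccos s`.  WHY TRUE: J. Cheeger, S.-T. Yau, Comm. Pure Appl. Math. 34 (1981) 465–480
(the heat kernel of a simply connected space form is radially non-increasing — the lemma behind their comparison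
theorem); equivalently `∂_s 𝔥_{S⁴} = 5e^{-4τ} 𝔥_{S⁶} > 0` (positivity of the heat kernel of `S⁶`).  Numerics: 0
violations (all seats).  Named Literature fact; dischargeable in Lean by the energy method of
`Literature.Analysis.SpecialFunctions.JacobiHeatPositivity` (positivity preservation for the ultraspherical heat
flow) + polynomial approximation of the delta.  Leans on: tree `zonal`; Mathlib `MonotoneOn`. -/
theorem stub_zonalMonotone :
    ∀ τ : ℝ, 0 < τ → MonotoneOn (zonal τ) (Set.Icc (-1) 1) :=
  -- LANDED (p86444): Theorems/CylinderEntropyThinCrossSectionExists…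
  Summit.SmoothPoincare4.SmoothPoincare4.Theorems.ThinCrossSectionExists.BallMassSlack.stub_zonalMonotone

/-- STUB C-dom (`stub_kernelDomination`; size M, real analysis).  From A and B: for every `τ > 0` there is a
profile `F : ℝ → ℝ`, antitone and non-negative, with (domination) `K_{p,τ}(y) ≤ F(d_N(y,p))` for all `p, y ∈ N` and
(exactness on the slice, through `ofReal`) `ofReal (F (d_N(y,e₀))) ≤ ofReal (K_{e₀,τ}(y))` for `y ∈ slice₀`, where
`K_{p,τ}(y) = cylKernel p τ y = 𝔥(τ,⟨y',p'⟩)·e^{-(y₅-p₅)²/4τ}` (`cylKernel_eq`), `d_N(y,p) = √(arccos⟨y',p'⟩² + (y₅-p₅)²)`,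
`e₀ = EuclideanSpace.single 0 1`.  PROOF: take `F r := max 0 (g r)` extended by `F r := F 0` for `r < 0`, where
`g r := 𝔥(τ, cos θ*)·e^{(θ*² - r²)/4τ}`, `θ* := min r π`.  Domination: with `θ := arccos⟨y',p'⟩ ∈ [0,π]`
(`|⟨y',p'⟩| ≤ 1`, tree `abs_sum_mul_le_one`, `Real.cos_arccos`), `r := d_N ≥ θ`, `θ ≤ θ* ≤ π`, A gives
`𝔥(τ,cos θ)e^{θ²/4τ} ≤ 𝔥(τ,cos θ*)e^{θ*²/4τ}`, multiply by `e^{-r²/4τ}` and use `θ² + (y₅-p₅)² = r²`.  Exactness: on the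
slice `y₅ = 0 = (e₀)₅`, `r = θ ≤ π`, `g(r) = 𝔥(τ, cos(arccos y₀)) = K_{e₀,τ}(y)` and `ofReal (max 0 g) = ofReal g`.
Antitone: on `[0,π]` by B (`cos` antitone there, `𝔥(τ,·)` monotone on `[-1,1]`); on `[π,∞)` `g = 𝔥(τ,-1)e^{(π²-r²)/4τ}`
is antitone if `𝔥(τ,-1) ≥ 0` and `max 0 g ≡ 0` there otherwise — in both cases `max 0 g` is antitone on `[0,∞)`
(no positivity of `𝔥` is assumed).  Leans on: tree `cylKernel_eq`, `abs_sum_mul_le_one`; Mathlib `Real.arccos_le_pi`,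
`Real.arccos_nonneg`, `Real.cos_arccos`, `Real.strictAntiOn_cos`/`Real.antitoneOn_cos`... , `Real.sqrt_le_sqrt`,
`Real.sq_sqrt`, `Antitone`. -/
theorem stub_kernelDomination :
    (∀ τ : ℝ, 0 < τ →
        MonotoneOn (fun θ : ℝ => zonal τ (Real.cos θ) * Real.exp (θ ^ 2 / (4 * τ))) (Set.Icc 0 Real.pi)) →
    (∀ τ : ℝ, 0 < τ → MonotoneOn (zonal τ) (Set.Icc (-1) 1)) →
      ∀ τ : ℝ, 0 < τ → ∃ F : ℝ → ℝ, Antitone F ∧ (∀ r : ℝ, 0 ≤ F r) ∧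
        (∀ p y : EuclideanSpace ℝ (Fin 6), ∑ i : Fin 5, p (Fin.castSucc i) ^ 2 = 1 → ∑ i : Fin 5, y (Fin.castSucc i) ^ 2 = 1 →
            cylKernel p τ y ≤ F (Real.sqrt (Real.arccos (∑ i : Fin 5, y (Fin.castSucc i) * p (Fin.castSucc i)) ^ 2 + (y 5 - p 5) ^ 2))) ∧
        (∀ y : EuclideanSpace ℝ (Fin 6), ∑ i : Fin 5, y (Fin.castSucc i) ^ 2 = 1 → y 5 = 0 →
            ENNReal.ofReal (F (Real.sqrt (Real.arccos (∑ i : Fin 5, y (Fin.castSucc i) * (EuclideanSpace.single 0 1 : EuclideanSpace ℝ (Fin 6)) (Fin.castSucc i)) ^ 2 + (y 5 - (EuclideanSpace.single 0 1 : EuclideanSpace ℝ (Fin 6)) 5) ^ 2))) ≤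
              ENNReal.ofReal (cylKernel (EuclideanSpace.single 0 1 : EuclideanSpace ℝ (Fin 6)) τ y)) :=
  -- LANDED (p88929): Theorems/CylinderEntropyThinCrossSectionExists…
  Summit.SmoothPoincare4.SmoothPoincare4.Theorems.ThinCrossSectionExists.BallMassSlack.stub_kernelDomination

/-- STUB C-level (`stub_levelComparison`; size M, measure theory).  BALL-MASS SLACK ⇒ LEVEL-SET SLACK: if
`S ⊆ N` has `Λ`-subspherical intrinsic ball mass (`μH⁴(S ∩ B̄ᴺ(q,r)) ≤ Λ·μH⁴(slice₀ ∩ B̄ᴺ(e₀,r))` for all `q ∈ N`,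
`r > 0`) and `F : ℝ → ℝ` is antitone, then for every centre `p ∈ N` and level `t`,
`μH⁴(S ∩ {F(d_N(·,p)) > t}) ≤ Λ·μH⁴(slice₀ ∩ {F(d_N(·,e₀)) > t})`.  PROOF: `I_t := {r | t < F r}` is a lower set of
`ℝ` (F antitone), so `I_t ∩ [0,∞)` is `∅`, `[0,∞)`, `[0,R]` or `[0,R)` (`R = sSup`, `0 ≤ R < ∞`), and
`y ∈ {F∘d_N > t} ↔ d_N(y,·) ∈ I_t` (`d_N ≥ 0`).  Case `∅`: both sides `0`.  Case `[0,∞)`: `S ∩ N = ⋃_n (S ∩ B̄ᴺ(p,n+1))`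
increasing, `measure_iUnion_eq_iSup`/`Monotone.measure_iUnion`, each term `≤ Λ·μH⁴(slice₀ ∩ B̄ᴺ(e₀,n+1)) ≤ Λ·μH⁴(slice₀)`.
Case `[0,R]`, `R > 0`: the sets ARE `S ∩ B̄ᴺ(p,R)` and `slice₀ ∩ B̄ᴺ(e₀,R)` (`√a ≤ R ↔ a ≤ R²`, `Real.sqrt_le_left` /
`Real.sqrt_le_sqrt`, `Real.le_sqrt`), hypothesis at `r = R`.  Case `[0,R]`, `R = 0`: `{y ∈ N | d_N(y,p) ≤ 0} ⊆ {p}`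
(`arccos⟨y',p'⟩ = 0 ⇒ ⟨y',p'⟩ ≥ 1 ⇒ y' = p'` for unit vectors, and `y₅ = p₅`), and `μH[4] {p} = 0`
(`MeasureTheory.Measure.noAtoms_hausdorff`).  Case `[0,R)`, `R > 0`: `{d_N < R} = ⋃_n B̄ᴺ(·, R·(n+1)/(n+2))` increasing;
continuity from below on the `S` side, monotonicity on the slice side.  Leans on: Mathlib `measure_iUnion_eq_iSup`
(or `MeasureTheory.tendsto_measure_iUnion_atTop`), `measure_mono`, `Real.sqrt_lt'`, `Real.sqrt_le'`,
`Real.arccos_nonneg`, `Real.arccos_eq_zero`, `Measure.noAtoms_hausdorff`, `Set.Subsingleton.measure_zero`. -/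
theorem stub_levelComparison :
    ∀ (Λ : ℝ≥0∞) (S : Set (EuclideanSpace ℝ (Fin 6))) (F : ℝ → ℝ) (p : EuclideanSpace ℝ (Fin 6)) (t : ℝ),
      (∀ y ∈ S, ∑ i : Fin 5, y (Fin.castSucc i) ^ 2 = 1) →
      (∀ p : EuclideanSpace ℝ (Fin 6), ∑ i : Fin 5, p (Fin.castSucc i) ^ 2 = 1 → ∀ r : ℝ, 0 < r →
          μH[4] (S ∩ {y : EuclideanSpace ℝ (Fin 6) | ∑ i : Fin 5, y (Fin.castSucc i) ^ 2 = 1 ∧ Real.arccos (∑ i : Fin 5, y (Fin.castSucc i) * p (Fin.castSucc i)) ^ 2 + (y 5 - p 5) ^ 2 ≤ r ^ 2}) ≤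
            Λ * μH[4] ({z : EuclideanSpace ℝ (Fin 6) | ∑ i : Fin 5, z (Fin.castSucc i) ^ 2 = 1 ∧ z 5 = 0} ∩
              {y : EuclideanSpace ℝ (Fin 6) | ∑ i : Fin 5, y (Fin.castSucc i) ^ 2 = 1 ∧ Real.arccos (∑ i : Fin 5, y (Fin.castSucc i) * (EuclideanSpace.single 0 1 : EuclideanSpace ℝ (Fin 6)) (Fin.castSucc i)) ^ 2 + (y 5 - (EuclideanSpace.single 0 1 : EuclideanSpace ℝ (Fin 6)) 5) ^ 2 ≤ r ^ 2})) →
      Antitone F → ∑ i : Fin 5, p (Fin.castSucc i) ^ 2 = 1 →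
        μH[4] (S ∩ {y : EuclideanSpace ℝ (Fin 6) | t < F (Real.sqrt (Real.arccos (∑ i : Fin 5, y (Fin.castSucc i) * p (Fin.castSucc i)) ^ 2 + (y 5 - p 5) ^ 2))}) ≤
            Λ * μH[4] ({z : EuclideanSpace ℝ (Fin 6) | ∑ i : Fin 5, z (Fin.castSucc i) ^ 2 = 1 ∧ z 5 = 0} ∩ {y : EuclideanSpace ℝ (Fin 6) | t < F (Real.sqrt (Real.arccos (∑ i : Fin 5, y (Fin.castSucc i) * (EuclideanSpace.single 0 1 : EuclideanSpace ℝ (Fin 6)) (Fin.castSucc i)) ^ 2 + (y 5 - (EuclideanSpace.single 0 1 : EuclideanSpace ℝ (Fin 6)) 5) ^ 2))}) :=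
  -- LANDED (p78255): Theorems/CylinderEntropyThinCrossSectionExists…
  Summit.SmoothPoincare4.SmoothPoincare4.Theorems.ThinCrossSectionExists.BallMassSlack.stub_levelComparison

/-- STUB C-core (`stub_layerCakeCore`; size M, measure theory — the `lintegral` layer cake).  Given `S ⊆ N`, a
centre `p ∈ N`, a scale `τ`, an antitone non-negative profile `F` dominating the kernel on `N`
(`K_{p,τ} ≤ F∘d_N(·,p)`) and dominated by it on the slice through `ofReal` (`ofReal F∘d_N(·,e₀) ≤ ofReal K_{e₀,τ}` on
`slice₀`), the per-level slack `μH⁴(S ∩ {F∘d_N(·,p) > t}) ≤ Λ·μH⁴(slice₀ ∩ {F∘d_N(·,e₀) > t})` for all `t > 0` integrates to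
`F̂_{p,τ}(S) ≤ Λ·F̂_{e₀,τ}(slice₀)` (typed `cylDensity`; the common factor `μH⁴(S⁴)⁻¹` cancels).  PROOF:
`cylDensity S p τ = c⁻¹ ∫⁻ y in S, ofReal (K y)`; (1) `ofReal K ≤ G` everywhere with `G y := if y ∈ N then ofReal (F (d_N y p)) else ⊤`
(`lintegral_mono`), and `G = ofReal ∘ F ∘ d_N` `(μH⁴.restrict S)`-a.e. because `(μH⁴.restrict S) Nᶜ = μH⁴(Nᶜ ∩ S) = 0`
(`Measure.restrict_apply` with the MEASURABLE test set `Nᶜ`; `S` itself need not be measurable); (2) layer cake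
`MeasureTheory.lintegral_eq_lintegral_meas_lt` for the real function `F ∘ d_N(·,p)` (non-negative; measurable:
`Antitone.measurable` and continuity of `y ↦ √(arccos⟨y',p'⟩² + (y₅-p₅)²)`, `Real.continuous_arccos`), giving
`∫⁻ t in Ioi 0, (μH⁴.restrict S) {t < F∘d_N}` and `Measure.restrict_apply` (measurable level sets); (3) the per-level
hypothesis and `lintegral_const_mul` / `lintegral_mono` (`t ↦ μ(slice₀ ∩ {t < F∘d})` is antitone hence measurable);
(4) layer cake backwards on `slice₀` (measurable: `measurableSet_range_sliceMap 0` + `range_sliceMap 0`) and the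
exactness hypothesis with `setLIntegral_mono'`; (5) multiply by `c⁻¹ = (μH⁴ S⁴)⁻¹` (`mul_left_comm`, `mul_le_mul_left'`).
Leans on: tree `cylDensity`, `range_sliceMap`, `measurableSet_range_sliceMap`; Mathlib `lintegral_eq_lintegral_meas_lt`,
`Measure.restrict_apply`, `lintegral_mono`, `lintegral_congr_ae`, `lintegral_const_mul`, `setLIntegral_mono'`. -/
theorem stub_layerCakeCore :
    ∀ (τ : ℝ) (Λ : ℝ≥0∞) (S : Set (EuclideanSpace ℝ (Fin 6))) (F : ℝ → ℝ) (p : EuclideanSpace ℝ (Fin 6)),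
      (∀ y ∈ S, ∑ i : Fin 5, y (Fin.castSucc i) ^ 2 = 1) →
      Antitone F → (∀ r : ℝ, 0 ≤ F r) → ∑ i : Fin 5, p (Fin.castSucc i) ^ 2 = 1 →
      (∀ y : EuclideanSpace ℝ (Fin 6), ∑ i : Fin 5, y (Fin.castSucc i) ^ 2 = 1 → cylKernel p τ y ≤ F (Real.sqrt (Real.arccos (∑ i : Fin 5, y (Fin.castSucc i) * p (Fin.castSucc i)) ^ 2 + (y 5 - p 5) ^ 2))) →
      (∀ y : EuclideanSpace ℝ (Fin 6), ∑ i : Fin 5, y (Fin.castSucc i) ^ 2 = 1 → y 5 = 0 →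
            ENNReal.ofReal (F (Real.sqrt (Real.arccos (∑ i : Fin 5, y (Fin.castSucc i) * (EuclideanSpace.single 0 1 : EuclideanSpace ℝ (Fin 6)) (Fin.castSucc i)) ^ 2 + (y 5 - (EuclideanSpace.single 0 1 : EuclideanSpace ℝ (Fin 6)) 5) ^ 2))) ≤
              ENNReal.ofReal (cylKernel (EuclideanSpace.single 0 1 : EuclideanSpace ℝ (Fin 6)) τ y)) →
      (∀ t : ℝ, 0 < t →
          μH[4] (S ∩ {y : EuclideanSpace ℝ (Fin 6) | t < F (Real.sqrt (Real.arccos (∑ i : Fin 5, y (Fin.castSucc i) * p (Fin.castSucc i)) ^ 2 + (y 5 - p 5) ^ 2))}) ≤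
            Λ * μH[4] ({z : EuclideanSpace ℝ (Fin 6) | ∑ i : Fin 5, z (Fin.castSucc i) ^ 2 = 1 ∧ z 5 = 0} ∩ {y : EuclideanSpace ℝ (Fin 6) | t < F (Real.sqrt (Real.arccos (∑ i : Fin 5, y (Fin.castSucc i) * (EuclideanSpace.single 0 1 : EuclideanSpace ℝ (Fin 6)) (Fin.castSucc i)) ^ 2 + (y 5 - (EuclideanSpace.single 0 1 : EuclideanSpace ℝ (Fin 6)) 5) ^ 2))})) →
        cylDensity S p τ ≤ Λ * cylDensity {z : EuclideanSpace ℝ (Fin 6) | ∑ i : Fin 5, z (Fin.castSucc i) ^ 2 = 1 ∧ z 5 = 0} (EuclideanSpace.single 0 1 : EuclideanSpace ℝ (Fin 6)) τ :=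
  -- LANDED (p78271): Theorems/CylinderEntropyThinCrossSectionExists…
  Summit.SmoothPoincare4.SmoothPoincare4.Theorems.ThinCrossSectionExists.BallMassSlack.stub_layerCakeCore

/-- STUB D (`stub_massSlackIntr`; OPEN — SPC4-strength, the HARDEST stub and the line's conjecture; content unchanged
from the planner's skeleton, vocabulary inlined).  Every homotopy 4-sphere `M` (bare summit frame) has a smooth
embedding `ι : M → ℝ⁶` into `N`, separating the two ends, and a `Λ < 4/e` with `Λ`-subspherical intrinsic ball mass
of its image.  WHY IT MIGHT BE TRUE / FAIL: implied by SPC4 (the slice through a diffeomorphism has `Λ = 1`: an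
off-slice intrinsic ball meets the slice in a cap of radius `√(r² - h²) ≤ r`, lead's support lemma
`subsphericalMassIntr_one_slice₀`); with H, A', B, C-* , the calibration item and the sibling crux R it implies
`M ≅ S⁴` (`massRigid`), so given R it is FALSE for an exotic `M` — it is E's SPC4 content in ball-count form
(`Disproof.crux_iff_spc4`).  No mechanism for a sphere not already known standard is claimed (card §Transfer,
triage r2-2); the lead holds this stub as the structure/refutation target.  Leans on: frame only. -/
theorem stub_massSlackIntr :
    ∀ (M : Type) [TopologicalSpace M] [T2Space M] [SecondCountableTopology M]
      [ChartedSpace (EuclideanSpace ℝ (Fin 4)) M] [IsManifold (𝓡 4) ∞ M],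
      M ≃ₕ (Metric.sphere (0 : EuclideanSpace ℝ (Fin 5)) 1) →
      ∃ ι : M → EuclideanSpace ℝ (Fin 6), Manifold.IsSmoothEmbedding (𝓡 4) (𝓡 6) ∞ ι ∧
        (∀ x, ∑ i : Fin 5, ι x (Fin.castSucc i) ^ 2 = 1) ∧
        (∃ R : ℝ, ∀ a b : EuclideanSpace ℝ (Fin 6), ∑ i : Fin 5, a (Fin.castSucc i) ^ 2 = 1 → ∑ i : Fin 5, b (Fin.castSucc i) ^ 2 = 1 → a 5 ≤ -R → R ≤ b 5 →
          ¬ JoinedIn ({z : EuclideanSpace ℝ (Fin 6) | ∑ i : Fin 5, z (Fin.castSucc i) ^ 2 = 1} \ Set.range ι) a b) ∧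
        ∃ Λ : ℝ≥0∞, Λ < ENNReal.ofReal (4 / Real.exp 1) ∧
          ∀ p : EuclideanSpace ℝ (Fin 6), ∑ i : Fin 5, p (Fin.castSucc i) ^ 2 = 1 → ∀ r : ℝ, 0 < r →
          μH[4] (Set.range ι ∩ {y : EuclideanSpace ℝ (Fin 6) | ∑ i : Fin 5, y (Fin.castSucc i) ^ 2 = 1 ∧ Real.arccos (∑ i : Fin 5, y (Fin.castSucc i) * p (Fin.castSucc i)) ^ 2 + (y 5 - p 5) ^ 2 ≤ r ^ 2}) ≤
            Λ * μH[4] ({z : EuclideanSpace ℝ (Fin 6) | ∑ i : Fin 5, z (Fin.castSucc i) ^ 2 = 1 ∧ z 5 = 0} ∩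
              {y : EuclideanSpace ℝ (Fin 6) | ∑ i : Fin 5, y (Fin.castSucc i) ^ 2 = 1 ∧ Real.arccos (∑ i : Fin 5, y (Fin.castSucc i) * (EuclideanSpace.single 0 1 : EuclideanSpace ℝ (Fin 6)) (Fin.castSucc i)) ^ 2 + (y 5 - (EuclideanSpace.single 0 1 : EuclideanSpace ℝ (Fin 6)) 5) ^ 2 ≤ r ^ 2}) := by
  sorry

/-! ## §2b The calibration stubs K1–K3 (lead-1 reshape): `λ_cyl(slice₀) = 1` inside the line

Signatures over Mathlib (`μHE`, set integrals on `Metric.sphere 0 1 ⊂ ℝ⁵`) + tree `gegen` / `zonal` / `cylDensity` only; each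
is a pure-proof `Theorems/` file.  Chained as hypotheses (K2 assumes K1's statement, K3 assumes K2's conclusion) so the three
workers are independent. -/

/-- STUB K1 (`stub_funkHeckeVanishing`; size M, TRUE — Funk–Hecke at order `0`).  For `k ≥ 1` and a unit vector `u ∈ ℝ⁵`,
the zonal Gegenbauer polynomial integrates to zero over the round `S⁴`:
`∫_{S⁴} C_k^{(3/2)}(⟨x,u⟩) dμHE⁴(x) = 0` (`gegen k` = the typed finite sum = `C_k^{(3/2)}`, landed `gegen_eq_eval_gp`).
PROOF (no coarea, no 1-D reduction): the tree's Killing-field identity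
`Literature.MeasureTheory.Hausdorff.integral_sphere_fderiv_rotation_eq_zero` (`∫_{S_r} DF(x)[⟨u,x⟩v - ⟨v,x⟩u] dμHE^k = 0` for
`C¹` `F`, orthonormal `u ⊥ v`, `finrank = k+1`; here `V = EuclideanSpace ℝ (Fin 5)`, `k = 4`, `r = 1`) applied to
`F(x) = ⟨v,x⟩ · g(⟨u,x⟩)` with `g = (C_k^{(3/2)})'` (a polynomial: `Polynomial.eval`, `ContDiff`) gives
`∫ [⟨u,x⟩ g(⟨u,x⟩) - ⟨v,x⟩² g'(⟨u,x⟩)] = 0`; summing over an orthonormal basis `v₁..v₄` of `uᗮ`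
(`∑_j ⟨v_j,x⟩² = ‖x‖² - ⟨u,x⟩² = 1 - s²` on the unit sphere — exactly the pattern of the tree's
`integral_sphere_exp_inner_mul_inner`, same file, which does this for `g = exp`) yields
`∫ [4 s C_k'(s) - (1 - s²) C_k''(s)]_{s = ⟨u,x⟩} = 0`, and the landed ultraspherical ODE
`Summit.SmoothPoincare4.SmoothPoincare4.Theorems.CylinderEntropySliceCalibration.eval_gp_ode`
(`(1 - s²) C_k'' - 4 s C_k' = -k(k+3) C_k`) turns the integrand into `k(k+3) C_k(s)`; divide by `k(k+3) ≠ 0`.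
Conversions: `⟪x, u⟫_ℝ = ∑ i, x i * u i` (`EuclideanSpace.inner_eq_star_dotProduct` / `PiLp.inner_apply`), `‖u‖ = 1 ↔ ∑ u_i² = 1`
(`EuclideanSpace.norm_eq`), `finrank_euclideanSpace_fin : finrank ℝ (EuclideanSpace ℝ (Fin 5)) = 5`.  Leans on: tree
`integral_sphere_fderiv_rotation_eq_zero`, `gegen_eq_eval_gp`, `eval_gp_ode`; Mathlib `Polynomial.contDiff`,
`Polynomial.deriv`, `stdOrthonormalBasis` / `OrthonormalBasis` of `(ℝ ∙ u)ᗮ`, `integral_finset_sum`, `integral_sub`. -/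
theorem stub_funkHeckeVanishing :
    ∀ k : ℕ, 1 ≤ k → ∀ u : EuclideanSpace ℝ (Fin 5), ∑ i : Fin 5, u i ^ 2 = 1 →
      ∫ x in Metric.sphere (0 : EuclideanSpace ℝ (Fin 5)) 1, gegen k (∑ i : Fin 5, x i * u i) ∂μHE[4] = 0 :=
  -- LANDED (p96785, lead-1 wave 1): Theorems/CylinderEntropyThinCrossSectionExistsStubFunkHeckeVanishing.lean
  Summit.SmoothPoincare4.SmoothPoincare4.Theorems.ThinCrossSectionExists.BallMassSlack.stub_funkHeckeVanishing

/-- STUB K2 (`stub_zonalSphereIntegral`; size M, TRUE — only the `k = 0` mode survives).  Given K1: for `τ > 0` and a unit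
`u ∈ ℝ⁵`, `∫_{S⁴} 𝔥(τ, ⟨x,u⟩) dμHE⁴(x) = μHE⁴(S⁴)` (as a real number).  PROOF: `zonal τ s = ∑' k, wt k τ * gegen k s`
(definition); on the sphere `|∑ x_i u_i| ≤ 1` (Cauchy–Schwarz, cf. tree `abs_sum_mul_le_one`), and the tree bound
`Literature.Geometry.Riemannian.SphericalZonalKernelSeries.norm_wt_mul_gegen_le` (with `R = 1`) dominates the `k`-th term
uniformly in `x` by a summable majorant (`summable_majorant`, same file), so
`MeasureTheory.integral_tsum_of_summable_integral_norm` (or `integral_tsum` with the uniform bound on a finite measure: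
`Literature.MeasureTheory.Hausdorff.euclideanHausdorffMeasure_sphere_lt_top`, `finrank_euclideanSpace_fin`) exchanges `∫` and
`∑'`; the `k ≥ 1` integrals vanish by the hypothesis (K1), the `k = 0` term is `wt 0 τ * gegen 0 s = 1` (`wt_zero`, `gegen_zero`)
whose set integral is `(μHE⁴ S⁴).toReal` (`setIntegral_const`, `smul_eq_mul`); `tsum_eq_single 0`.  Continuity /
measurability of the terms: `gegen k` is a polynomial in `s` (continuous), `x ↦ ∑ x_i u_i` continuous.  Leans on: tree `zonal`,
`wt`, `gegen`, `wt_zero`, `gegen_zero`, `norm_wt_mul_gegen_le`, `summable_majorant`, `summable_wt_mul_gegen`,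
`euclideanHausdorffMeasure_sphere_lt_top`; Mathlib `integral_tsum_of_summable_integral_norm`, `setIntegral_const`. -/
theorem stub_zonalSphereIntegral :
    (∀ k : ℕ, 1 ≤ k → ∀ u : EuclideanSpace ℝ (Fin 5), ∑ i : Fin 5, u i ^ 2 = 1 →
      ∫ x in Metric.sphere (0 : EuclideanSpace ℝ (Fin 5)) 1, gegen k (∑ i : Fin 5, x i * u i) ∂μHE[4] = 0) →
    ∀ τ : ℝ, 0 < τ → ∀ u : EuclideanSpace ℝ (Fin 5), ∑ i : Fin 5, u i ^ 2 = 1 →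
      ∫ x in Metric.sphere (0 : EuclideanSpace ℝ (Fin 5)) 1, zonal τ (∑ i : Fin 5, x i * u i) ∂μHE[4] =
        (μHE[4] (Metric.sphere (0 : EuclideanSpace ℝ (Fin 5)) 1)).toReal :=
  -- LANDED (p97290, parallel seat prover-line-stmt-SmoothPoincare4-7633-c1-0 shadowing wave 1):
  -- Theorems/CylinderEntropyThinCrossSectionExistsStubZonalSphereIntegral.lean
  Summit.SmoothPoincare4.SmoothPoincare4.Theorems.ThinCrossSectionExists.BallMassSlack.stub_zonalSphereIntegral

/-- STUB K3 (`stub_sliceDensity`; size M, TRUE — the typed density of the slice is the Gaussian height factor).  Given K2's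
conclusion: for every centre `p ∈ N` and scale `τ > 0`, `F̂_{p,τ}(slice₀) = e^{-p₅²/4τ}` as typed
(`cylDensity slice₀ p τ = ofReal (exp (-p₅²/(4τ)))`).  PROOF: `cylDensity A p τ = (μH⁴ S⁴)⁻¹ * ∫⁻ z in A, ofReal (cylKernel p τ z)`
and `cylKernel_eq : cylKernel p τ z = zonal τ (∑ z_i p_i) * exp (-(z₅-p₅)²/(4τ))`; on `slice₀` `z₅ = 0`, so the Gaussian factor is
the constant `exp (-p₅²/4τ)` (`setLIntegral_congr_fun` with the measurable slice, `(0 - p₅)² = p₅²`), and `zonal ≥ 0` there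
(`Literature.Geometry.Riemannian.SphericalZonalFourPositivity.zonal_nonneg` on `[-1,1]` + `abs_sum_mul_le_one`) lets
`ENNReal.ofReal_mul` / `lintegral_const_mul'` pull it out.  TRANSFER `slice₀ → S⁴ ⊂ ℝ⁵`: `slice₀ = Set.range (sliceMap 0)`
(`range_sliceMap 0`), `sliceMap 0 = padL ∘ Subtype.val` up to `+ 0 • axis` (`sliceMap`, `padL_apply_castSucc`, `padL_apply_last`),
and `padL` is a linear isometry `ℝ⁵ → ℝ⁶` (`norm_padL` ⇒ `Isometry`), so `Isometry.map_hausdorffMeasure`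
(`Measure.map padL μH[4] = μH[4].restrict (range padL)`) + `Measure.restrict_map` / `MeasurableEmbedding.lintegral_map`
(or `lintegral_map_equiv` through `LinearIsometry`) give
`∫⁻ z in slice₀, G z ∂μH⁴ = ∫⁻ x in Metric.sphere 0 1, G (padL x) ∂μH⁴` with `(padL x) (castSucc i) = x i`, `(padL x) 5 = 0`.
MEASURES: `μHE[4] = c • μH[4]` on `ℝ⁵` with `c = addHaarScalarFactor … ≠ 0` (`Measure.euclideanHausdorffMeasure_def`,
`addHaarScalarFactor_volume_hausdorffMeasure_ne_zero`), so `∫⁻ … ∂μH⁴ = c⁻¹ * ∫⁻ … ∂μHE⁴` (`lintegral_smul_measure`,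
`Measure.restrict_smul`) and `μH⁴(S⁴) = c⁻¹ μHE⁴(S⁴)`; INTEGRAL ↔ LINTEGRAL: the integrand is continuous, non-negative and bounded on
the finite-measure sphere, hence integrable, and `MeasureTheory.ofReal_integral_eq_lintegral_ofReal` turns K2's
`∫ zonal = (μHE⁴ S⁴).toReal` into `∫⁻ ofReal ∘ zonal = μHE⁴(S⁴)` (`ENNReal.ofReal_toReal`, finiteness
`euclideanHausdorffMeasure_sphere_lt_top`); finally `(μH⁴ S⁴)⁻¹ * μH⁴ S⁴ = 1` (`ENNReal.inv_mul_cancel`, tree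
`hausdorffMeasure_sphere_four_pos` / `_lt_top`).  The unit vector fed to K2 is `u i := p (castSucc i)` (e.g. tree `truncL p`,
`truncL_apply`).  Leans on: tree `cylDensity`, `cylKernel_eq`, `zonal_nonneg`, `abs_sum_mul_le_one`, `range_sliceMap`, `sliceMap`,
`padL`, `norm_padL`, `isometry_sliceMap`, `hausdorffMeasure_range_sliceMap`, `measurableSet_range_sliceMap`,
`hausdorffMeasure_sphere_four_pos/lt_top`, `truncL`; Mathlib `Isometry.map_hausdorffMeasure`, `lintegral_map`,
`Measure.euclideanHausdorffMeasure_def`, `ofReal_integral_eq_lintegral_ofReal`, `lintegral_const_mul'`. -/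
theorem stub_sliceDensity :
    (∀ τ : ℝ, 0 < τ → ∀ u : EuclideanSpace ℝ (Fin 5), ∑ i : Fin 5, u i ^ 2 = 1 →
      ∫ x in Metric.sphere (0 : EuclideanSpace ℝ (Fin 5)) 1, zonal τ (∑ i : Fin 5, x i * u i) ∂μHE[4] =
        (μHE[4] (Metric.sphere (0 : EuclideanSpace ℝ (Fin 5)) 1)).toReal) →
    ∀ p : EuclideanSpace ℝ (Fin 6), ∑ i : Fin 5, p (Fin.castSucc i) ^ 2 = 1 → ∀ τ : ℝ, 0 < τ →
      cylDensity {z : EuclideanSpace ℝ (Fin 6) | ∑ i : Fin 5, z (Fin.castSucc i) ^ 2 = 1 ∧ z 5 = 0} p τ =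
        ENNReal.ofReal (Real.exp (-((p 5) ^ 2) / (4 * τ))) :=
  -- LANDED (p96858, parallel seat prover-line-stmt-SmoothPoincare4-7633-c1-0 shadowing wave 1):
  -- Theorems/CylinderEntropyThinCrossSectionExistsStubSliceDensity.lean
  Summit.SmoothPoincare4.SmoothPoincare4.Theorems.ThinCrossSectionExists.BallMassSlack.stub_sliceDensity

/-! ## §3 Glue (proved): the stubs give the calibration and the crux -/

/-- **K1 → K2 → K3 composed**: the typed density of the slice at every centre and scale. -/
theorem cylDensity_slice₀_eq {p : E⁶} (hp : InN p) {τ : ℝ} (hτ : 0 < τ) :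
    cylDensity slice₀ p τ = ENNReal.ofReal (Real.exp (-((p 5) ^ 2) / (4 * τ))) :=
  stub_sliceDensity (stub_zonalSphereIntegral stub_funkHeckeVanishing) p hp τ hτ

/-- The `≤ 1` half of the calibration: `λ_cyl(slice₀) ≤ 1` (`e^{-p₅²/4τ} ≤ 1`). -/
theorem cylEntropy_slice₀_le_one : cylEntropy slice₀ ≤ 1 := by
  show (⨆ (p : E⁶) (_ : ∑ i : Fin 5, p (Fin.castSucc i) ^ 2 = 1) (τ : ℝ) (_ : 0 < τ),
    cylDensity slice₀ p τ) ≤ 1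
  refine iSup₂_le fun p hp => iSup₂_le fun τ hτ => ?_
  rw [cylDensity_slice₀_eq hp hτ]
  refine ENNReal.ofReal_le_one.2 (Real.exp_le_one_iff.2 ?_)
  exact div_nonpos_of_nonpos_of_nonneg (neg_nonpos.2 (sq_nonneg _)) (by positivity)

/-- **The route's support item `SliceCalibration` (7634) is a THEOREM of the line**: `λ_cyl(slice₀) = 1`
(`≤` from K1–K3, `≥` is the tree's `one_le_cylEntropy_slice 0`, the `τ → ∞` end of the supremum). -/
theorem sliceCalibration_holds : SliceCalibration := by
  rw [sliceCalibration_iff]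
  refine le_antisymm cylEntropy_slice₀_le_one ?_
  have h := Literature.Geometry.Riemannian.SphericalCylinderEntropy.one_le_cylEntropy_slice 0
  rwa [range_sliceMap] at h

/-- The named statement of STUB A (planner's `HarnackRadial`), now DERIVED from H by A'. -/
def HarnackRadial : Prop :=
  ∀ τ : ℝ, 0 < τ →
        MonotoneOn (fun θ : ℝ => zonal τ (Real.cos θ) * Real.exp (θ ^ 2 / (4 * τ))) (Set.Icc 0 Real.pi)

/-- The named statement of STUB B. -/
def ZonalMonotone : Prop := ∀ τ : ℝ, 0 < τ → MonotoneOn (zonal τ) (Set.Icc (-1) 1)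

theorem harnackRadial_holds : HarnackRadial := stub_harnackRadial_of_convex stub_hamiltonConvex
theorem zonalMonotone_holds : ZonalMonotone := stub_zonalMonotone

/-- `SubsphericalMassIntr` is the inlined registered text (definitional). -/
theorem subsphericalMassIntr_iff (Λ : ℝ≥0∞) (S : Set E⁶) :
    SubsphericalMassIntr Λ S ↔
      ∀ p : EuclideanSpace ℝ (Fin 6), ∑ i : Fin 5, p (Fin.castSucc i) ^ 2 = 1 → ∀ r : ℝ, 0 < r →
          μH[4] (S ∩ {y : EuclideanSpace ℝ (Fin 6) | ∑ i : Fin 5, y (Fin.castSucc i) ^ 2 = 1 ∧ Real.arccos (∑ i : Fin 5, y (Fin.castSucc i) * p (Fin.castSucc i)) ^ 2 + (y 5 - p 5) ^ 2 ≤ r ^ 2}) ≤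
            Λ * μH[4] ({z : EuclideanSpace ℝ (Fin 6) | ∑ i : Fin 5, z (Fin.castSucc i) ^ 2 = 1 ∧ z 5 = 0} ∩
              {y : EuclideanSpace ℝ (Fin 6) | ∑ i : Fin 5, y (Fin.castSucc i) ^ 2 = 1 ∧ Real.arccos (∑ i : Fin 5, y (Fin.castSucc i) * (EuclideanSpace.single 0 1 : EuclideanSpace ℝ (Fin 6)) (Fin.castSucc i)) ^ 2 + (y 5 - (EuclideanSpace.single 0 1 : EuclideanSpace ℝ (Fin 6)) 5) ^ 2 ≤ r ^ 2}) :=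
  Iff.rfl

/-- **The lever, relative form at one centre and scale** (C-dom + C-level + C-core from A and B): a set `S ⊆ N`
with `Λ`-subspherical intrinsic ball mass has `F̂_{p,τ}(S) ≤ Λ·F̂_{e₀,τ}(slice₀)` for every `p ∈ N`, `τ > 0`. -/
theorem cylDensity_le_of_subspherical (hA : HarnackRadial) (hB : ZonalMonotone) {Λ : ℝ≥0∞} {S : Set E⁶}
    (hS : ∀ y ∈ S, InN y) (hm : SubsphericalMassIntr Λ S) {p : E⁶} (hp : InN p) {τ : ℝ} (hτ : 0 < τ) :
    cylDensity S p τ ≤ Λ * cylDensity slice₀ e₀ τ := by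
  obtain ⟨F, hFa, hF0, hdom, hex⟩ := stub_kernelDomination hA hB τ hτ
  exact stub_layerCakeCore τ Λ S F p hS hFa hF0 hp (fun y hy => hdom p y hp hy) hex
    (fun t _ => stub_levelComparison Λ S F p t hS hm hFa hp)

/-- **The lever, absolute form** (+ the calibration item 7634): `λ_cyl(S) ≤ Λ`. -/
theorem cylEntropy_le_of_subspherical (hA : HarnackRadial) (hB : ZonalMonotone) (hcal : SliceCalibration)
    {Λ : ℝ≥0∞} {S : Set E⁶} (hS : ∀ y ∈ S, InN y) (hm : SubsphericalMassIntr Λ S) : cylEntropy S ≤ Λ := by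
  have h1 : cylEntropy slice₀ = 1 := sliceCalibration_iff.mp hcal
  show (⨆ (p : E⁶) (_ : ∑ i : Fin 5, p (Fin.castSucc i) ^ 2 = 1) (τ : ℝ) (_ : 0 < τ),
    cylDensity S p τ) ≤ Λ
  refine iSup₂_le fun p hp => iSup₂_le fun τ hτ => ?_
  calc cylDensity S p τ ≤ Λ * cylDensity slice₀ e₀ τ := cylDensity_le_of_subspherical hA hB hS hm hp hτ
    _ ≤ Λ * cylEntropy slice₀ := by
        gcongr
        exact le_iSup_of_le e₀ (le_iSup_of_le inN_e₀ (le_iSup_of_le τ (le_iSup_of_le hτ le_rfl)))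
    _ = Λ := by rw [h1, mul_one]

/-- Strict form used by the composition. -/
theorem cylEntropy_lt_level_of_subspherical (hA : HarnackRadial) (hB : ZonalMonotone) (hcal : SliceCalibration)
    {Λ : ℝ≥0∞} (hΛ : Λ < level) {S : Set E⁶} (hS : ∀ y ∈ S, InN y) (hm : SubsphericalMassIntr Λ S) :
    cylEntropy S < level :=
  lt_of_le_of_lt (cylEntropy_le_of_subspherical hA hB hcal hS hm) hΛ

/-! ### Name-keyed alias of the one OPEN statement (the hypothesis of the composition) -/
namespace Registered

/-- Alias of STUB D keyed by the registered stub name (the only open stub; H, A', B, C-dom, C-level, C-core are landed theorems). -/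
abbrev stub_massSlackIntr : Prop :=
    ∀ (M : Type) [TopologicalSpace M] [T2Space M] [SecondCountableTopology M]
      [ChartedSpace (EuclideanSpace ℝ (Fin 4)) M] [IsManifold (𝓡 4) ∞ M],
      M ≃ₕ (Metric.sphere (0 : EuclideanSpace ℝ (Fin 5)) 1) →
      ∃ ι : M → EuclideanSpace ℝ (Fin 6), Manifold.IsSmoothEmbedding (𝓡 4) (𝓡 6) ∞ ι ∧
        (∀ x, ∑ i : Fin 5, ι x (Fin.castSucc i) ^ 2 = 1) ∧
        (∃ R : ℝ, ∀ a b : EuclideanSpace ℝ (Fin 6), ∑ i : Fin 5, a (Fin.castSucc i) ^ 2 = 1 → ∑ i : Fin 5, b (Fin.castSucc i) ^ 2 = 1 → a 5 ≤ -R → R ≤ b 5 →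
          ¬ JoinedIn ({z : EuclideanSpace ℝ (Fin 6) | ∑ i : Fin 5, z (Fin.castSucc i) ^ 2 = 1} \ Set.range ι) a b) ∧
        ∃ Λ : ℝ≥0∞, Λ < ENNReal.ofReal (4 / Real.exp 1) ∧
          ∀ p : EuclideanSpace ℝ (Fin 6), ∑ i : Fin 5, p (Fin.castSucc i) ^ 2 = 1 → ∀ r : ℝ, 0 < r →
          μH[4] (Set.range ι ∩ {y : EuclideanSpace ℝ (Fin 6) | ∑ i : Fin 5, y (Fin.castSucc i) ^ 2 = 1 ∧ Real.arccos (∑ i : Fin 5, y (Fin.castSucc i) * p (Fin.castSucc i)) ^ 2 + (y 5 - p 5) ^ 2 ≤ r ^ 2}) ≤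
            Λ * μH[4] ({z : EuclideanSpace ℝ (Fin 6) | ∑ i : Fin 5, z (Fin.castSucc i) ^ 2 = 1 ∧ z 5 = 0} ∩
              {y : EuclideanSpace ℝ (Fin 6) | ∑ i : Fin 5, y (Fin.castSucc i) ^ 2 = 1 ∧ Real.arccos (∑ i : Fin 5, y (Fin.castSucc i) * (EuclideanSpace.single 0 1 : EuclideanSpace ℝ (Fin 6)) (Fin.castSucc i)) ^ 2 + (y 5 - (EuclideanSpace.single 0 1 : EuclideanSpace ℝ (Fin 6)) 5) ^ 2 ≤ r ^ 2})

end Registered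

/-! ## §4 The composition: the one crux-sized stub D implies the crux, BY NAME; H, A', B, C-* enter as landed theorems, K1–K3 as stubs -/

/-- **`ThinCrossSectionExists` from STUB D alone** (pure logic plus the §3 glue; the six analytic / measure-theoretic stubs
H, A', B, C-dom, C-level, C-core are the landed theorems `stub_hamiltonConvex` (p93995), `stub_harnackRadial_of_convex` (p78724),
`stub_zonalMonotone` (p86444), `stub_kernelDomination` (p88929), `stub_levelComparison` (p78255), `stub_layerCakeCore` (p78271),
and the calibration `λ_cyl(slice₀) = 1` is `sliceCalibration_holds` from K1–K3): D supplies, for each homotopy 4-sphere, a smooth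
end-separating cross-section with `Λ`-subspherical intrinsic ball mass for some `Λ < 4/e`; the lever gives `λ_cyl ≤ Λ < 4/e` for
ITS OWN image.  No diffeomorphism `M ≅ S⁴` is formed; `SmoothPoincare4` is not upstream.  (Tree twin:
`Theorems/CylinderEntropyThinCrossSectionExistsOfMassSlack.lean`, `thinCrossSectionExists_of_massSlackIntr`, p95451, which takes
`λ_cyl(slice₀) ≤ 1` as a hypothesis — discharged by `cylEntropy_slice₀_le_one` once K1–K3 land.) -/
theorem ThinCrossSectionExists_of (hD : Registered.stub_massSlackIntr) : ThinCrossSectionExists := by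
  rw [crux_iff]
  intro M _ _ _ _ _ e
  obtain ⟨ι, hι, hN, hsep, Λ, hΛ, hmass⟩ := hD M e
  have hS : ∀ y ∈ Set.range ι, InN y := by
    rintro _ ⟨x, rfl⟩
    exact hN x
  exact ⟨ι, hι, hN, hsep,
    cylEntropy_lt_level_of_subspherical harnackRadial_holds zonalMonotone_holds sliceCalibration_holds hΛ hS hmass⟩

/-- Wiring check: the registered open stub feeds `ThinCrossSectionExists_of` as stated. -/
example : ThinCrossSectionExists :=
  ThinCrossSectionExists_of stub_massSlackIntr

/-! ## §5 R-side corollary (proved from the stubs): mass-pinching rigidity in the cylinder -/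

/-- **`massRigid`** — given the recognition crux R (`CylinderRungTwo`, item 7631), H, A', B, C-* and K1–K3:
a homotopy 4-sphere realised in `N` by a smooth end-separating embedding whose image has `Λ`-subspherical intrinsic
ball mass for some `Λ < 4/e` is diffeomorphic to `S⁴`.  This is the only way `D ⇒ SPC4` is known. -/
theorem massRigid (hR : CylinderRungTwo) (hA : HarnackRadial) (hB : ZonalMonotone)
    (M : Type) [TopologicalSpace M] [T2Space M] [SecondCountableTopology M]
    [ChartedSpace E⁴ M] [IsManifold (𝓡 4) ∞ M] (e : M ≃ₕ 𝕊⁴)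
    (ι : M → E⁶) (hι : Manifold.IsSmoothEmbedding (𝓡 4) (𝓡 6) ∞ ι) (hN : ∀ x, InN (ι x))
    (hsep : Separates (Set.range ι)) {Λ : ℝ≥0∞} (hΛ : Λ < level)
    (hmass : SubsphericalMassIntr Λ (Set.range ι)) :
    Nonempty (M ≃ₘ⟮𝓡 4, 𝓡 4⟯ 𝕊⁴) := by
  have hS : ∀ y ∈ Set.range ι, InN y := by
    rintro _ ⟨x, rfl⟩
    exact hN x
  have hthin : cylEntropy (Set.range ι) < level :=
    cylEntropy_lt_level_of_subspherical hA hB sliceCalibration_holds hΛ hS hmass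
  obtain ⟨R, hR'⟩ := hsep
  exact hR M e ι hι hN ⟨R, hR'⟩ hthin

/-! ## §6 The `M = S⁴` instance of D (landed): the slice is `1`-subspherical from every centre -/

/-- **Non-vacuity of the supply D at `S⁴`**: the unit slice has `1`-subspherical intrinsic ball mass — an off-slice intrinsic
ball meets the slice in a geodesic cap of radius `√(r² - h²) ≤ r`, and caps of equal radius have equal `μH⁴` by `O(5)`-invariance
(landed `ballMass_slice_le`, p90628, `Theorems/CylinderEntropyThinCrossSectionExistsSliceBallMass.lean`). -/
theorem subsphericalMassIntr_one_slice₀ : SubsphericalMassIntr 1 slice₀ := by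
  intro p hp r hr
  rw [one_mul]
  exact Summit.SmoothPoincare4.SmoothPoincare4.Theorems.ThinCrossSectionExists.BallMassSlack.ballMass_slice_le p hp r hr

end Summit.SmoothPoincare4.SmoothPoincare4.Cruxes.ThinCrossSectionExists.BallMassSlack

end
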